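import Summits.CriticalPhenomena.CardyFormulaZ2.Theorems.CardyComplexConeDefs

/-!
# Discrete Green regrouping of the `q = 1` vertex relations over a face rectangle
(line `qkz-strip-boundary-arm` of crux `CardyComplexCone.EdgePrecompact`, stmt-CriticalPhenomena-11387;
registered sub-goal `fluxBoundaryIdentity`, piece N2 of the necessity certificate
"`UniformInnerEnvelope` ⇒ cube-root upper bound for the half-plane one-arm probability of bond-ℤ²")

Pure finite-sum algebra over `ℂ`, no percolation and no topology. The variables `Fc x y k`
(`x y : ℤ`, `k : Fin 4`) stand for the corner observable at the corner `((x, y), k)`. The two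
hypotheses are Smirnov's vertex relations at the vertical edges `{(x, y), (x, y + 1)}`,
`a < x < b`, `0 ≤ y < h`, and at the horizontal edges `{(x, y), (x + 1, y)}`, `a ≤ x < b`, `0 ≤ y < h`,
of the face rectangle `[a, b] × [0, h]`. Summing the vertical relations with multiplier `1` and the
horizontal ones with multiplier `-i` and regrouping by corners, every interior corner cancels and
only the eight displayed boundary families survive (bottom wall `Fc x 0 3`, `Fc x 0 2`; left column
`Fc a y 0`, `Fc a y 3`; top row `Fc x h 2`, `Fc x h 3`; right column `Fc b y 1`, `Fc b y 2`).

Proof: the two families of relations are summed over their index rectangles (`Finset.sum_eq_zero`),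
the sums are distributed, the shifted sums `∑_{y ∈ Ico 0 h} Fc x (y + 1) k`,
`∑_{x ∈ Ico a b} Fc (x + 1) y k` are re-indexed over `Ioc` (`Finset.sum_Ico_add'`,
`Finset.Ico_add_one_add_one_eq_Ioc`), every `Ico`/`Ioc` sum is split into its endpoint and the
`Ioo` sum (`Finset.Ico_eq_cons_Ioo`, `Finset.Ioc_eq_cons_Ioo`), and the goal is the linear combination
`(vertical sum) - (i · horizontal sum)` of the two vanishing sums (`linear_combination`, the only
non-polynomial input being `Complex.I_mul_I`).

References: S. Smirnov, *Critical percolation in the plane*, C. R. Acad. Sci. Paris 333 (2001), §2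
(the vertex relation of the exploration observable); H. Duminil-Copin, S. Smirnov, *Conformal invariance
of lattice models*, arXiv:1109.1549, §8 (discrete contour sums of the half Cauchy–Riemann relations).
-/

namespace Summit.CriticalPhenomena.CardyFormulaZ2.Cruxes.EdgePrecompact.QkzStripBoundaryArm

open MeasureTheory Filter Set Metric
open scoped Topology BigOperators Pointwise
open Literature.Probability.LatticeModels Literature.Probability.Percolation
open Literature.Probability.RandomPlanarGeometry (DobrushinDomain)
open Summit.CriticalPhenomena.CardyFormulaZ2.Theses.CardyComplexCone

noncomputable section

/-- Re-indexing a unit shift: `∑_{y ∈ [c, d)} g (y + 1) = ∑_{y ∈ (c, d]} g y` over `ℤ`. -/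
private theorem sum_Ico_succ_eq_sum_Ioc_N2 (g : ℤ → ℂ) (c d : ℤ) :
    ∑ y ∈ Finset.Ico c d, g (y + 1) = ∑ y ∈ Finset.Ioc c d, g y := by
  rw [Finset.sum_Ico_add' g c d 1, Finset.Ico_add_one_add_one_eq_Ioc]

/-- Splitting off the left endpoint: `∑_{x ∈ [a, b)} g x = g a + ∑_{x ∈ (a, b)} g x` for `a < b`. -/
private theorem sum_Ico_eq_add_sum_Ioo_N2 {a b : ℤ} (hab : a < b) (g : ℤ → ℂ) :
    ∑ x ∈ Finset.Ico a b, g x = g a + ∑ x ∈ Finset.Ioo a b, g x := by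
  rw [Finset.Ico_eq_cons_Ioo hab, Finset.sum_cons]

/-- Splitting off the right endpoint: `∑_{x ∈ (a, b]} g x = g b + ∑_{x ∈ (a, b)} g x` for `a < b`. -/
private theorem sum_Ioc_eq_add_sum_Ioo_N2 {a b : ℤ} (hab : a < b) (g : ℤ → ℂ) :
    ∑ x ∈ Finset.Ioc a b, g x = g b + ∑ x ∈ Finset.Ioo a b, g x := by
  rw [Finset.Ioc_eq_cons_Ioo hab, Finset.sum_cons]

/-- **Discrete Green regrouping of the `q = 1` vertex relations over the face rectangle
`[a, b] × [0, h]`** (piece N2 of the necessity certificate of crux `EdgePrecompact`). Under the vertical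
vertex relations `Fc x y 1 - Fc x (y+1) 3 = i (Fc x (y+1) 2 - Fc x y 0)` (`a < x < b`, `0 ≤ y < h`) and
the horizontal ones `Fc x y 0 - Fc (x+1) y 2 = i (Fc (x+1) y 1 - Fc x y 3)` (`a ≤ x < b`, `0 ≤ y < h`),
the boundary combination of single sums displayed in the conclusion vanishes: it is the sum of the
vertical relations minus `i` times the sum of the horizontal relations, regrouped by corners. -/
theorem fluxBoundaryIdentity : ∀ (Fc : ℤ → ℤ → Fin 4 → ℂ) (a b h : ℤ), a < b → 0 < h → (∀ x y : ℤ, a < x → x < b → 0 ≤ y → y < h → Fc x y 1 - Fc x (y + 1) 3 = Complex.I * (Fc x (y + 1) 2 - Fc x y 0)) → (∀ x y : ℤ, a ≤ x → x < b → 0 ≤ y → y < h → Fc x y 0 - Fc (x + 1) y 2 = Complex.I * (Fc (x + 1) y 1 - Fc x y 3)) → (∑ x ∈ Finset.Ico a b, Fc x 0 3) + Complex.I * (∑ x ∈ Finset.Ioc a b, Fc x 0 2) - Complex.I * (∑ y ∈ Finset.Ico 0 h, Fc a y 0) + (∑ y ∈ Finset.Ioo 0 h, Fc a y 3) - Complex.I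 * (∑ x ∈ Finset.Ioo a b, Fc x h 2) - (∑ x ∈ Finset.Ioo a b, Fc x h 3) - (∑ y ∈ Finset.Ico 0 h, Fc b y 1) + Complex.I * (∑ y ∈ Finset.Ioo 0 h, Fc b y 2) = 0 := by
  intro Fc a b h hab hh hV hH
  -- (1) the vertical relations, summed over `a < x < b`, `0 ≤ y < h`
  have hVs : ∑ x ∈ Finset.Ioo a b, ∑ y ∈ Finset.Ico 0 h,
      (Fc x y 1 - Fc x (y + 1) 3 - Complex.I * (Fc x (y + 1) 2 - Fc x y 0)) = 0 := by
    refine Finset.sum_eq_zero fun x hx => Finset.sum_eq_zero fun y hy => ?_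
    rw [Finset.mem_Ioo] at hx
    rw [Finset.mem_Ico] at hy
    rw [hV x y hx.1 hx.2 hy.1 hy.2, sub_self]
  -- (2) `i` times the horizontal relations, summed over `a ≤ x < b`, `0 ≤ y < h` (using `i² = -1`)
  have hHs : ∑ x ∈ Finset.Ico a b, ∑ y ∈ Finset.Ico 0 h,
      (Complex.I * (Fc x y 0 - Fc (x + 1) y 2) + (Fc (x + 1) y 1 - Fc x y 3)) = 0 := by
    refine Finset.sum_eq_zero fun x hx => Finset.sum_eq_zero fun y hy => ?_
    rw [Finset.mem_Ico] at hx hy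
    rw [hH x y hx.1 hx.2 hy.1 hy.2]
    linear_combination (Fc (x + 1) y 1 - Fc x y 3) * Complex.I_mul_I
  -- (3) distribute the double sums
  simp only [Finset.sum_sub_distrib, Finset.sum_add_distrib, ← Finset.mul_sum] at hVs hHs
  -- (4) re-index the shifted sums and split off the new endpoint
  have sy : ∀ (x : ℤ) (k : Fin 4), ∑ y ∈ Finset.Ico 0 h, Fc x (y + 1) k =
      Fc x h k + ∑ y ∈ Finset.Ioo 0 h, Fc x y k := fun x k => by
    rw [sum_Ico_succ_eq_sum_Ioc_N2 (fun y => Fc x y k) 0 h, sum_Ioc_eq_add_sum_Ioo_N2 hh]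
  have sx : ∀ k : Fin 4, ∑ x ∈ Finset.Ico a b, ∑ y ∈ Finset.Ico 0 h, Fc (x + 1) y k =
      ∑ y ∈ Finset.Ico 0 h, Fc b y k + ∑ x ∈ Finset.Ioo a b, ∑ y ∈ Finset.Ico 0 h, Fc x y k :=
    fun k => by
    rw [sum_Ico_succ_eq_sum_Ioc_N2 (fun x => ∑ y ∈ Finset.Ico 0 h, Fc x y k) a b,
      sum_Ioc_eq_add_sum_Ioo_N2 hab]
  simp only [sy, sx] at hVs hHs
  -- (5) split every remaining `Ico` / `Ioc` sum into its endpoint and the `Ioo` sum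
  simp only [sum_Ico_eq_add_sum_Ioo_N2 hab, sum_Ioc_eq_add_sum_Ioo_N2 hab,
    sum_Ico_eq_add_sum_Ioo_N2 hh, Finset.sum_add_distrib] at hVs hHs ⊢
  -- (6) regroup by corners
  linear_combination hVs - hHs

end

end Summit.CriticalPhenomena.CardyFormulaZ2.Cruxes.EdgePrecompact.QkzStripBoundaryArm
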